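import Mathlib
import Summits.ValiantsHypothesis.ValiantsHypothesis.Theses.LiouvilleSarnak

/-!
# Crux `LiouvilleSarnak.DigitalBilinearLiouville` (stmt-ValiantsHypothesis-14774) — line `tt_star`

Skeleton line (line-writer `linewriter-valiant-liouvmonotone-1-g0`, 2026-08-31).

The crux: for every balanced cut `π` of the `2n` bit positions, the `2^n × 2^n` sign matrix
`M_π(r,c) = λ(N_π(r,c) + 1)` has operator norm `o(2^n)` uniformly in `π`:
`|Σ_{r,c} u_r w_c M_π(r,c)|² ≤ ε 4^n ‖u‖² ‖w‖²` for `n ≥ n₀(ε)`.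

THE CUT (`T T^*` / duality — remove the test vectors):

* `stub_fourthMoment` (linear algebra, M, PROVABLE NOW): for ANY finite matrix `M` and vectors `u, w`,
  `|Σ_{r,c} u_r w_c M_{rc}|⁴ ≤ (Σ_{r,r'} |Σ_c M_{rc} conj(M_{r'c})|²) · ‖u‖⁴ · ‖w‖⁴`
  (two Cauchy–Schwarz steps: `|S|² ≤ ‖w‖² Σ_c |Σ_r u_r M_{rc}|²`, and
  `Σ_c |Σ_r u_r M_{rc}|² = Σ_{r,r'} u_r conj(u_{r'}) G_{rr'} ≤ ‖u‖² ‖G‖_F` with `G = M M^*`; no spectral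
  theorem needed).
* `stub_twoPointDigital` (OPEN — the arithmetic content, test-vector free): the PAIR-CORRELATION sum of the
  digital families is small on average over pairs of rows:
  `Σ_{r,r'} |Σ_c λ(N_π(r,c)+1) λ(N_π(r',c)+1)|² ≤ ε 16^n` for `n ≥ n₀(ε)`, every balanced `π`.
  (Trivial bound `16^n`; the diagonal `r = r'` contributes exactly `8^n`, so the statement is about
  `r ≠ r'`.)  For the ALIGNED cut (`N = 2^n r + c`) this is a mean-square short-interval two-point
  Chowla statement: `Σ_{d ∈ 2^n ℤ} Σ_r |Σ_{c < 2^n} λ(2^n r + c + 1) λ(2^n r + c + d + 1)|² = o(16^n)` —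
  cancellation of `λ(m) λ(m+d)` inside most blocks of length `2^n = √X`, for most shifts `d` that are
  multiples of `2^n`; Matomäki–Radziwiłł–Tao's averaged Chowla averages over ALL shifts `d ≤ H`, not over
  this sparse structured set, so even the aligned instance is a genuine (smaller) open question — it is
  the natural first rung of this line (cf. item AlignedTypeI, stmt-21040, the Type-I aligned rung).
* `DigitalBilinearLiouville_of`: composition (kernel-checked): Stub 2 at `ε²`, Stub 1, and
  `a² ≤ b²  ⇒  a ≤ b` for `a, b ≥ 0`.

TRANSFER (honest label): by `‖M M^*‖_F² ≤ ‖M‖_op² ‖M‖_F² = ‖M‖_op² 4^n` the open stub is implied back by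
the crux (with `ε ↦ ε`), so Stub 2 is an EQUIVALENT form of the crux (`ε ↔ ε²`), not a weakening.  Why
it is the better currency: it has no test vectors `u, w` (no supremum over the unit ball) and is an
explicit fourth-order arithmetic sum — a two-point correlation of `λ` along the digital families — which
is the shape analytic number theory attacks (van der Corput / `T T^*`, Type I–II decompositions,
Mauduit–Rivat digital methods, MRT averaged Chowla); the crux's bilinear form with arbitrary `u, w` is not.
-/

set_option linter.dupNamespace false

namespace Summit.ValiantsHypothesis.ValiantsHypothesis.Cruxes.DigitalBilinearLiouville.TtStar

open Summit.ValiantsHypothesis.ValiantsHypothesis.Theses.LiouvilleSarnak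

/-- **Stub 1 — fourth moment / `T T^*` bound (linear algebra; provable now).**  For any finite complex
matrix `M` and test vectors `u, w`:
`|Σ_r Σ_c u_r w_c M_{rc}|⁴ ≤ (Σ_{r,r'} |Σ_c M_{rc} conj(M_{r'c})|²) (Σ_r |u_r|²)² (Σ_c |w_c|²)²`.
[folklore] -/
theorem stub_fourthMoment :
    ∀ {ι κ : Type} [Fintype ι] [Fintype κ] (M : ι → κ → ℂ) (u : ι → ℂ) (w : κ → ℂ),
      ‖∑ r, ∑ c, u r * w c * M r c‖ ^ 4 ≤
        (∑ r, ∑ r', ‖∑ c, M r c * star (M r' c)‖ ^ 2) *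
          (∑ r, ‖u r‖ ^ 2) ^ 2 * (∑ c, ‖w c‖ ^ 2) ^ 2 := by
  sorry

/-- **Stub 2 — two-point digital decorrelation (OPEN; the arithmetic content, test-vector free).**
For every `ε > 0`, all large `n` and every balanced cut `π`, the pair-correlation sum of the row families
`c ↦ λ(N_π(r,c)+1)` is at most `ε 16^n` (trivial bound `16^n`, diagonal `8^n`).
[cite: MatomakiRadziwillTao2015, Theorem 1.1] [cite: MauduitRivat2010, Théorème 1] -/
theorem stub_twoPointDigital :
    ∀ ε : ℝ, 0 < ε → ∃ n₀ : ℕ, ∀ n ≥ n₀, ∀ π : Fin n ⊕ Fin n ≃ Fin (2 * n),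
      (∑ r : Fin n → Bool, ∑ r' : Fin n → Bool,
        ‖∑ c : Fin n → Bool,
          ((ArithmeticFunction.liouville
              (Nat.ofBits (fun j : Fin (2 * n) => Sum.elim r c (π.symm j)) + 1) : ℤ) : ℂ) *
          ((ArithmeticFunction.liouville
              (Nat.ofBits (fun j : Fin (2 * n) => Sum.elim r' c (π.symm j)) + 1) : ℤ) : ℂ)‖ ^ 2) ≤
      ε * 16 ^ n := by
  sorry

/-- **Composition (kernel-checked).**  Apply Stub 2 at `ε²`; Stub 1 with
`M = M_π` (real entries, so `star` is the identity) gives `|S|⁴ ≤ ε² 16^n ‖u‖⁴ ‖w‖⁴ = (ε 4^n ‖u‖² ‖w‖²)²`,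
and both sides are squares of nonnegative reals. [folklore] -/
theorem DigitalBilinearLiouville_of : DigitalBilinearLiouville := by
  intro ε hε
  obtain ⟨n₀, hn₀⟩ := stub_twoPointDigital (ε ^ 2) (by positivity)
  refine ⟨n₀, fun n hn π u w => ?_⟩
  -- the matrix, with `star`-invariant (integer) entries
  set M : (Fin n → Bool) → (Fin n → Bool) → ℂ := fun r c =>
    ((ArithmeticFunction.liouville
      (Nat.ofBits (fun j : Fin (2 * n) => Sum.elim r c (π.symm j)) + 1) : ℤ) : ℂ) with hM
  have hstar : ∀ r c, star (M r c) = M r c := by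
    intro r c
    simp only [hM, Complex.star_def, map_intCast]
  have h2 := hn₀ n hn π
  have h4 := stub_fourthMoment M u w
  simp only [hstar] at h4
  -- abbreviations for the nonnegative quantities
  set S : ℝ := ‖∑ r, ∑ c, u r * w c * M r c‖ with hS
  set U : ℝ := ∑ r, ‖u r‖ ^ 2 with hU
  set V : ℝ := ∑ c, ‖w c‖ ^ 2 with hV
  set G : ℝ := ∑ r : Fin n → Bool, ∑ r' : Fin n → Bool, ‖∑ c : Fin n → Bool, M r c * M r' c‖ ^ 2
    with hG
  have hU0 : 0 ≤ U := Finset.sum_nonneg fun _ _ => by positivity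
  have hV0 : 0 ≤ V := Finset.sum_nonneg fun _ _ => by positivity
  have hS0 : 0 ≤ S := norm_nonneg _
  have hG2 : G ≤ ε ^ 2 * 16 ^ n := h2
  -- |S|^4 ≤ (ε 4^n U V)^2
  have hsq : (S ^ 2) ^ 2 ≤ (ε * 4 ^ n * U * V) ^ 2 := by
    have h16 : (16 : ℝ) ^ n = (4 ^ n) ^ 2 := by
      rw [← pow_mul, show (16 : ℝ) = 4 ^ 2 by norm_num, ← pow_mul, Nat.mul_comm]
    calc (S ^ 2) ^ 2 = S ^ 4 := by ring
      _ ≤ G * U ^ 2 * V ^ 2 := h4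
      _ ≤ ε ^ 2 * 16 ^ n * U ^ 2 * V ^ 2 := by gcongr
      _ = (ε * 4 ^ n * U * V) ^ 2 := by rw [h16]; ring
  have hrhs0 : 0 ≤ ε * 4 ^ n * U * V := by positivity
  have := (pow_le_pow_iff_left₀ (by positivity) hrhs0 two_ne_zero).mp hsq
  simpa [hS, hU, hV, mul_assoc] using this

end Summit.ValiantsHypothesis.ValiantsHypothesis.Cruxes.DigitalBilinearLiouville.TtStar
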